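import Summits.AtomisticToContinuum.Crystallization.Theorems.FrustratedLawDichotomyAtlasDoor
import Summits.AtomisticToContinuum.Crystallization.Theorems.FrustratedLawDichotomyTransportPriceLocal

/-!
# FrustratedLawDichotomy · crux `AperiodicFrustratedLawGap` (stmt-AtomisticToContinuum-27623) — THE CELL-FREE PULL KERNEL (ZONE-TRANSPORT, generic part)
# (decomp-a2c, RESIDUAL lens-5 «finite/base range + asymptotic regime + bridge», generation 114; node «ZONE-TRANSPORT» r1847 L2a, SPEC ZONE-TRANSPORT-SPEC-g114 §1)

The transported atlas door (228′) `…AtlasDoorTransport.aperiodicFrustratedLawGap_of_atlasTransport` books row floors on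
`rootEnergy V_LJ μ + net F G μ` for two covariant `ℝ≥0∞` kernels.  The ZONE-TRANSPORT line uses `F = 0` and ONE backward («pull») kernel which is
CELL-FREE and PLANE-FREE: «every MARKED (host-like) root pulls the weight `w y` from every UNMARKED atom `y` within distance `R`».  This file is
the generic, kernel-checked part of that design over an ABSTRACT covariant mark `Hm : Measure E3 → E3 → Prop` («the atom of `μ` at `y` is
host-like»), with its two structural hypotheses kept explicit: covariance under re-rooting
`hshift : Hm (μ.map (· - y)) z ↔ Hm μ (z + y)` and joint measurability `MeasurableSet {p | Hm p.1 p.2}`.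

* §1 `pullSet`, `pullKernel Hm R w μ y := 1[Hm μ 0 ∧ ‖y‖ ≤ R ∧ ¬ Hm μ y]·w y`; evaluation lemmas; ★ `measurable_pullKernel` (K4: joint measurability
  from the mark's — no measurability of the re-rooting map is needed); ★ `pullKernel_reroot_eq_zero` / `lintegral_inflow_pullKernel_eq_zero` (K1:
  NOBODY PULLS FROM A MARKED ROOT — the in-flow vanishes identically at marked roots, by covariance alone); `net_zero_pullKernel_of_mark` (at a
  marked root `net 0 G = out_G ≥ 0`) and ★ `floor_add_net_of_floor` (K2: EVERY EXISTING ROW FLOOR `c + m ≤ rootEnergy` on marked roots is a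
  transported row floor `c + m ≤ rootEnergy + net 0 G` verbatim); `net_zero_pullKernel_of_not_mark` (an unmarked root's net is `− in_G ≤ 0`:
  the residual side carries the in-flow); ★ `exists_outflow_bound_pullKernel` (K3: uniform out-flow bound on rooted hard-core configurations for
  a bounded weight, from the tree's `exists_outflow_bound_of_finiteRange`) — i.e. the door's clauses `hG`, `hBG`/`hGb` for this kernel, and
  `hF`/`hFb` for `F = 0` (`measurable_zero_kernel`, `lintegral_zero_kernel`).
* §2 the weight of record `zoneWeight y := ENNReal.ofReal (−V_LJ ‖y‖ / 2)` («half the attractive part of the bond»): measurable, bounded by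
  `1/24` (`neg_one_div_le_lennardJones`), zero on the repulsive core; `zonePull Hm R := pullKernel Hm R zoneWeight` with the three door clauses bundled
  (`measurable_zonePull`, `exists_outflow_bound_zonePull`, `lintegral_inflow_zonePull_eq_zero`).

What is NOT here (hand-2 «ZoneKernel», hand-1 «zoneFloor», SPEC §5): the CONCRETE mark (radius-`R_A′` half-window `τ_A`-coherent to a host
template) with its covariance and closedness, the evaluation of `out_G` on a D-facing cell, and the near-half floor.  Imports: tree (228)
`…AtlasDoor` (hence `…SignedLedger.net`) and `…TransportPriceLocal`; 0 sorry.  Tags: [folklore: bookkeeping / measure theory].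
-/

noncomputable section

namespace Summit.AtomisticToContinuum.Crystallization.Theorems.FrustratedLawDichotomyPullKernel

open MeasureTheory Metric Set Filter
open scoped ENNReal Topology BigOperators
open Literature.MathematicalPhysics.StatisticalMechanics Literature.Probability.Process
open Summit.AtomisticToContinuum.Crystallization.Theorems.ChargedEnergyGapNegative (E3 eStar)
open Summit.AtomisticToContinuum.Crystallization.Theorems.FrustratedLawDichotomySignedLedger (net)
open Summit.AtomisticToContinuum.Crystallization.Theorems.FrustratedLawDichotomyTransportPriceLocal (exists_outflow_bound_of_finiteRange)

variable {Hm : Measure E3 → E3 → Prop} {R : ℝ} {w : E3 → ℝ≥0∞}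

/-! ## §1. The pull kernel of an abstract covariant mark -/

/-- The set of (configuration, atom position) pairs along which the root PULLS: the root is marked, the atom lies within `R`, the atom is unmarked. -/
def pullSet (Hm : Measure E3 → E3 → Prop) (R : ℝ) : Set (Measure E3 × E3) :=
  {p | Hm p.1 0 ∧ ‖p.2‖ ≤ R ∧ ¬ Hm p.1 p.2}

/-- **The cell-free pull kernel** `G(μ, y) = 1[Hm μ 0 ∧ ‖y‖ ≤ R ∧ ¬ Hm μ y] · w y`: a marked root pulls the weight `w y` from every unmarked atom
within `R` (backward kernel `G` of `…SignedLedger.net 0 G`). -/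
def pullKernel (Hm : Measure E3 → E3 → Prop) (R : ℝ) (w : E3 → ℝ≥0∞) : Measure E3 → E3 → ℝ≥0∞ :=
  fun μ y => (pullSet Hm R).indicator (fun p => w p.2) (μ, y)

/-- Membership in the pull set, unfolded. -/
theorem mem_pullSet_iff {μ : Measure E3} {y : E3} : (μ, y) ∈ pullSet Hm R ↔ Hm μ 0 ∧ ‖y‖ ≤ R ∧ ¬ Hm μ y := Iff.rfl

/-- Evaluation on the pull set. -/
theorem pullKernel_of_mem {μ : Measure E3} {y : E3} (h0 : Hm μ 0) (hR : ‖y‖ ≤ R) (hy : ¬ Hm μ y) : pullKernel Hm R w μ y = w y :=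
  indicator_of_mem (mem_pullSet_iff.mpr ⟨h0, hR, hy⟩) _

/-- The pull kernel is dominated by the weight. -/
theorem pullKernel_le (μ : Measure E3) (y : E3) : pullKernel Hm R w μ y ≤ w y :=
  indicator_le_self' (fun _ _ => zero_le) (μ, y)

/-- Finite range: nothing is pulled from beyond `R`. -/
theorem pullKernel_eq_zero_of_lt_norm {μ : Measure E3} {y : E3} (h : R < ‖y‖) : pullKernel Hm R w μ y = 0 :=
  indicator_of_notMem (fun hp => (not_le.mpr h) (mem_pullSet_iff.mp hp).2.1) _

/-- Marked atoms are never pulled from. -/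
theorem pullKernel_eq_zero_of_mark {μ : Measure E3} {y : E3} (h : Hm μ y) : pullKernel Hm R w μ y = 0 :=
  indicator_of_notMem (fun hp => (mem_pullSet_iff.mp hp).2.2 h) _

/-- Unmarked roots pull nothing. -/
theorem pullKernel_eq_zero_of_not_mark_root {μ : Measure E3} (h : ¬ Hm μ 0) (y : E3) : pullKernel Hm R w μ y = 0 :=
  indicator_of_notMem (fun hp => h (mem_pullSet_iff.mp hp).1) _

/-- The pull set is measurable as soon as the mark is jointly measurable. [folklore] -/
theorem measurableSet_pullSet (hmeas : MeasurableSet {p : Measure E3 × E3 | Hm p.1 p.2}) (R : ℝ) : MeasurableSet (pullSet Hm R) := by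
  have h0 : MeasurableSet {p : Measure E3 × E3 | Hm p.1 0} := by
    have hm : Measurable fun p : Measure E3 × E3 => (p.1, (0 : E3)) := measurable_fst.prodMk measurable_const
    exact hm hmeas
  have hR : MeasurableSet {p : Measure E3 × E3 | ‖p.2‖ ≤ R} := measurable_snd.norm measurableSet_Iic
  have h : pullSet Hm R = {p : Measure E3 × E3 | Hm p.1 0} ∩ {p | ‖p.2‖ ≤ R} ∩ {p : Measure E3 × E3 | Hm p.1 p.2}ᶜ := by
    ext p; simp only [pullSet, mem_setOf_eq, mem_inter_iff, mem_compl_iff]; tauto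
  rw [h]
  exact (h0.inter hR).inter hmeas.compl

/-- ★ **(K4) Joint measurability of the pull kernel** from the mark's joint measurability and a measurable weight — no measurability of the
re-rooting map is used. [folklore] -/
theorem measurable_pullKernel (hmeas : MeasurableSet {p : Measure E3 × E3 | Hm p.1 p.2}) (hw : Measurable w) :
    Measurable (Function.uncurry (pullKernel Hm R w)) :=
  (hw.comp measurable_snd).indicator (measurableSet_pullSet hmeas R)

/-- ★ **(K1) Nobody pulls from a marked root**: re-rooted at an atom `y`, the kernel evaluated back at the old root `−y` vanishes, by covariance
`Hm (θ_y μ) (−y) ↔ Hm μ 0`. [folklore] -/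
theorem pullKernel_reroot_eq_zero (hshift : ∀ (μ : Measure E3) (y z : E3), Hm (μ.map fun x => x - y) z ↔ Hm μ (z + y)) {μ : Measure E3}
    (h0 : Hm μ 0) (y : E3) : pullKernel Hm R w (μ.map fun x => x - y) (-y) = 0 :=
  pullKernel_eq_zero_of_mark ((hshift μ y (-y)).mpr (by rwa [neg_add_cancel]))

/-- **(K1, integrated)** the in-flow of the pull kernel vanishes identically at a marked root. [folklore] -/
theorem lintegral_inflow_pullKernel_eq_zero (hshift : ∀ (μ : Measure E3) (y z : E3), Hm (μ.map fun x => x - y) z ↔ Hm μ (z + y))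
    {μ : Measure E3} (h0 : Hm μ 0) : ∫⁻ y, pullKernel Hm R w (μ.map fun x => x - y) (-y) ∂μ = 0 := by
  simp_rw [pullKernel_reroot_eq_zero hshift h0, lintegral_zero]

/-- The out-flow of the ZERO kernel vanishes. -/
theorem lintegral_outflow_zero_kernel (μ : Measure E3) : ∫⁻ y, (0 : Measure E3 → E3 → ℝ≥0∞) μ y ∂μ = 0 := by
  simp only [Pi.zero_apply, lintegral_zero]

/-- The in-flow of the ZERO kernel vanishes. -/
theorem lintegral_inflow_zero_kernel (μ : Measure E3) : ∫⁻ y, (0 : Measure E3 → E3 → ℝ≥0∞) (μ.map fun x => x - y) (-y) ∂μ = 0 := by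
  simp only [Pi.zero_apply, lintegral_zero]

/-- The zero kernel is jointly measurable (door clause `hF` for `F = 0`). -/
theorem measurable_zero_kernel : Measurable (Function.uncurry (0 : Measure E3 → E3 → ℝ≥0∞)) := measurable_const

/-- The zero kernel has zero out-flow on every configuration (door clause `hFb` for `F = 0`, any bound). -/
theorem lintegral_outflow_zero_kernel_le (μ : Measure E3) (B : ℝ≥0∞) : ∫⁻ y, (0 : Measure E3 → E3 → ℝ≥0∞) μ y ∂μ ≤ B := by
  rw [lintegral_outflow_zero_kernel]; exact zero_le

/-- **At a marked root the net flow of `(F, G) = (0, pull)` is the out-flow** `(∫⁻ y, G μ y ∂μ).toReal ≥ 0`. [folklore] -/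
theorem net_zero_pullKernel_of_mark (hshift : ∀ (μ : Measure E3) (y z : E3), Hm (μ.map fun x => x - y) z ↔ Hm μ (z + y))
    {μ : Measure E3} (h0 : Hm μ 0) : net 0 (pullKernel Hm R w) μ = (∫⁻ y, pullKernel Hm R w μ y ∂μ).toReal := by
  unfold net
  rw [lintegral_inflow_pullKernel_eq_zero hshift h0, lintegral_inflow_zero_kernel, lintegral_outflow_zero_kernel]
  simp

/-- **At an unmarked root the net flow of `(0, pull)` is minus the in-flow** (the residual side carries what is pulled from it). [folklore] -/
theorem net_zero_pullKernel_of_not_mark {μ : Measure E3} (h0 : ¬ Hm μ 0) :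
    net 0 (pullKernel Hm R w) μ = -(∫⁻ y, pullKernel Hm R w (μ.map fun x => x - y) (-y) ∂μ).toReal := by
  unfold net
  rw [lintegral_inflow_zero_kernel, lintegral_outflow_zero_kernel]
  simp [pullKernel_eq_zero_of_not_mark_root h0]

/-- At a marked root the net flow is non-negative. -/
theorem net_zero_pullKernel_nonneg_of_mark (hshift : ∀ (μ : Measure E3) (y z : E3), Hm (μ.map fun x => x - y) z ↔ Hm μ (z + y))
    {μ : Measure E3} (h0 : Hm μ 0) : 0 ≤ net 0 (pullKernel Hm R w) μ := by
  rw [net_zero_pullKernel_of_mark hshift h0]; exact ENNReal.toReal_nonneg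

/-- ★ **(K2) Existing row floors transport verbatim**: on a marked root, `c + m ≤ rootEnergy V μ` gives `c + m ≤ rootEnergy V μ + net 0 G μ`
(the (228′) `hfloor` of every class-A / class-H row from its (228) `hfloor`). [folklore] -/
theorem floor_add_net_of_floor (hshift : ∀ (μ : Measure E3) (y z : E3), Hm (μ.map fun x => x - y) z ↔ Hm μ (z + y))
    {μ : Measure E3} (h0 : Hm μ 0) {V : ℝ → ℝ} {c m : ℝ} (h : c + m ≤ rootEnergy V μ) :
    c + m ≤ rootEnergy V μ + net 0 (pullKernel Hm R w) μ :=
  h.trans (le_add_of_nonneg_right (net_zero_pullKernel_nonneg_of_mark hshift h0))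

/-- **(K2, with income)** on a marked root a floor on `rootEnergy + out_G` IS a transported floor (the Z-row reading). [folklore] -/
theorem floor_add_net_of_floor_outflow (hshift : ∀ (μ : Measure E3) (y z : E3), Hm (μ.map fun x => x - y) z ↔ Hm μ (z + y))
    {μ : Measure E3} (h0 : Hm μ 0) {V : ℝ → ℝ} {c m : ℝ} (h : c + m ≤ rootEnergy V μ + (∫⁻ y, pullKernel Hm R w μ y ∂μ).toReal) :
    c + m ≤ rootEnergy V μ + net 0 (pullKernel Hm R w) μ := by
  rwa [net_zero_pullKernel_of_mark hshift h0]

/-- ★ **(K3) Uniform out-flow bound** on rooted `δ`-hard-core configurations for a weight bounded by a finite `M` (door clauses `hBG`, `hGb`). [folklore] -/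
theorem exists_outflow_bound_pullKernel {δ : ℝ} (hδ : 0 < δ) (Hm : Measure E3 → E3 → Prop) (R : ℝ) {M : ℝ≥0∞} (hM : M ≠ ∞)
    (hw : ∀ y, w y ≤ M) : ∃ B : ℝ≥0∞, B ≠ ∞ ∧ ∀ μ : Measure E3, IsRootedHardCore δ μ → ∫⁻ y, pullKernel Hm R w μ y ∂μ ≤ B := by
  obtain ⟨C, hC, hCb⟩ := exists_outflow_bound_of_finiteRange hδ R hM
  exact ⟨C, hC, fun μ hμ => hCb μ hμ _ (fun y => (pullKernel_le μ y).trans (hw y)) fun y hy => pullKernel_eq_zero_of_lt_norm hy⟩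

/-! ## §2. The weight of record: half the attractive part of the Lennard-Jones bond -/

/-- `zoneWeight y = (−V_LJ(‖y‖) / 2)⁺` as an extended non-negative real: half the attractive part of the bond to `y`. -/
def zoneWeight (y : E3) : ℝ≥0∞ := ENNReal.ofReal (-(lennardJones ‖y‖) / 2)

/-- The zone weight is measurable (the tree's `measurable_lennardJones` lives in a Palm file not imported here; the two-line proof is inlined
to avoid a printed duplicate). -/
theorem measurable_zoneWeight : Measurable zoneWeight := by
  have hV : Measurable lennardJones := by
    unfold lennardJones
    exact ((measurable_inv.pow_const 12).const_mul _).sub ((measurable_inv.pow_const 6).const_mul _)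
  exact ENNReal.measurable_ofReal.comp ((hV.comp measurable_norm).neg.div_const 2)

/-- The zone weight is at most `1/24` (`V_LJ ≥ −1/12`). -/
theorem zoneWeight_le (y : E3) : zoneWeight y ≤ ENNReal.ofReal (1 / 24) := by
  refine ENNReal.ofReal_le_ofReal ?_
  have h := neg_one_div_le_lennardJones ‖y‖
  linarith

/-- The zone weight as a real number: `(zoneWeight y).toReal = max (−V_LJ ‖y‖ / 2) 0`. -/
theorem toReal_zoneWeight (y : E3) : (zoneWeight y).toReal = max (-(lennardJones ‖y‖) / 2) 0 := by
  unfold zoneWeight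
  rcases le_or_gt 0 (-(lennardJones ‖y‖) / 2) with h | h
  · rw [ENNReal.toReal_ofReal h, max_eq_left h]
  · rw [ENNReal.ofReal_of_nonpos h.le, max_eq_right h.le]; rfl

/-- On the repulsive core (`V_LJ ≥ 0`) nothing is pulled. -/
theorem zoneWeight_eq_zero_of_nonneg {y : E3} (h : 0 ≤ lennardJones ‖y‖) : zoneWeight y = 0 :=
  ENNReal.ofReal_of_nonpos (by linarith)

/-- **The zone pull kernel of record** for a mark `Hm` and pull radius `R`. -/
def zonePull (Hm : Measure E3 → E3 → Prop) (R : ℝ) : Measure E3 → E3 → ℝ≥0∞ := pullKernel Hm R zoneWeight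

/-- Door clause `hG` for the zone pull kernel. -/
theorem measurable_zonePull (hmeas : MeasurableSet {p : Measure E3 × E3 | Hm p.1 p.2}) : Measurable (Function.uncurry (zonePull Hm R)) :=
  measurable_pullKernel hmeas measurable_zoneWeight

/-- Door clauses `hBG`/`hGb` for the zone pull kernel. -/
theorem exists_outflow_bound_zonePull {δ : ℝ} (hδ : 0 < δ) (Hm : Measure E3 → E3 → Prop) (R : ℝ) :
    ∃ B : ℝ≥0∞, B ≠ ∞ ∧ ∀ μ : Measure E3, IsRootedHardCore δ μ → ∫⁻ y, zonePull Hm R μ y ∂μ ≤ B :=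
  exists_outflow_bound_pullKernel hδ Hm R ENNReal.ofReal_ne_top zoneWeight_le

/-- (K1) for the zone pull kernel: zero in-flow at marked roots. -/
theorem lintegral_inflow_zonePull_eq_zero (hshift : ∀ (μ : Measure E3) (y z : E3), Hm (μ.map fun x => x - y) z ↔ Hm μ (z + y))
    {μ : Measure E3} (h0 : Hm μ 0) : ∫⁻ y, zonePull Hm R (μ.map fun x => x - y) (-y) ∂μ = 0 :=
  lintegral_inflow_pullKernel_eq_zero hshift h0

/-- (K2) for the zone pull kernel: class-A / class-H row floors transport verbatim on marked roots. -/
theorem floor_add_net_zonePull_of_floor (hshift : ∀ (μ : Measure E3) (y z : E3), Hm (μ.map fun x => x - y) z ↔ Hm μ (z + y))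
    {μ : Measure E3} (h0 : Hm μ 0) {V : ℝ → ℝ} {c m : ℝ} (h : c + m ≤ rootEnergy V μ) : c + m ≤ rootEnergy V μ + net 0 (zonePull Hm R) μ :=
  floor_add_net_of_floor hshift h0 h

end Summit.AtomisticToContinuum.Crystallization.Theorems.FrustratedLawDichotomyPullKernel

end
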